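import Summits.ResolutionOfSingularities.ResolutionOfSingularities.Theorems.FrobeniusClosingSteerGeoDictResiduePRank
import HarnessLib

/-!
# Crux `Steer` (stmt-ResolutionOfSingularities-16345), chain W4.1, §σ2.29 GEOMETRIC re-cut — the GEOMETRIC DATUM of a chain ring:
# `R_P = A_{P ∩ A}` is a chart of the finitely generated model at a NON-MAXIMAL prime of coheight `dim A − height P`
# (Theses-free, def-free research support; res-L0-w41-plan-1 RULING 152a, F-A3-geom engine edit, brick)

OURS (campaign `res-hironaka`, rung L ★L-G4, slot W4.1; statements about the route's own objects; they replace the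
role of no printed item and are NOT statements of the manuscript under review [claim: Hironaka2017, status:
under-review]; AI review is weaker than expert review). Seat res-D-pv-003 (gen 6). For a finitely generated
`k`-subalgebra `A ⊆ K` of Krull dimension `n`, `R = A_{𝔪_O ∩ A}` (`locAtCentre A O`, a LOCAL ring), a prime `P ≠ 𝔪_R` of
height `c`, and the chain ring `T = R_P ⊆ K` (`∀ z, z ∈ T ↔ z = a / b, a ∈ R, b ∈ R ∖ P`), the prime `Q = P ∩ A` is
(i) prime, (ii) STRICTLY below the prime `𝔪_R ∩ A` (an element of `𝔪_R ∖ P` is `a / c` with `a, c ∈ A`, `c` a unit of `R`,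
and then `a ∈ (𝔪_R ∩ A) ∖ Q`), (iii) of coheight `dim (A ⧸ Q) = n − c` (res-D-pv-012's
`GeoDict.ringKrullDim_model_quotient_eq_of_locChar`, the affine dimension formula), and (iv) `T = A_Q` inside `K`
(res-D-pv-012's `GeoDict.locChar_model_of_locChar`) — i.e. `T` is a GEOMETRIC CHART `IsGeomChart A Q T` of the words of
record (res-L0-w41-strat-2 §σ2.29 (W1)) at a non-maximal prime, with the coheight that (W2′)/(W4) ask for when
`c = n − 1`. `exists_geomDatum_of_locChar` packages (i)–(iv). [cite: Matsumura1987, Thm. 5.6] [folklore]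
-/

noncomputable section

-- `Summit.<S>.<S>.…` duplicates the summit name by design (single-problem summit).
set_option linter.dupNamespace false

open IsLocalRing

namespace Summit.ResolutionOfSingularities.ResolutionOfSingularities.Theorems.SwitchingDichotomy

open Literature.AlgebraicGeometry.Resolution

namespace GeoDict

universe u

variable {K : Type u} [Field K] {k : Type u} [Field k] [Algebra k K]

variable (O : ValuationSubring K) (A : Subalgebra k K) {R : Subring K} (hR : locAtCentre A.toSubring O = R)
  {P : Ideal R} [hP : P.IsPrime] {T : Subring K} (hT : ∀ z : K, z ∈ T ↔ ∃ a b : R, b ∉ P ∧ z = (a : K) / b)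
include hR

/-- **(ii) `P ∩ A` is STRICTLY below `𝔪_R ∩ A`** when `P ≠ 𝔪_R` (`R = A_{𝔪_O ∩ A}` local): an element `r ∈ 𝔪_R ∖ P` is `a / c`
with `a, c ∈ A`, `v(c) = 1`, so `c` is a unit of `R` and `a = r·c ∈ (𝔪_R ∩ A) ∖ (P ∩ A)`. [folklore] -/
theorem comap_model_lt_comap_maximalIdeal [IsLocalRing R] (hPne : P ≠ maximalIdeal R) :
    P.comap (Subring.inclusion (model_le_of_locAtCentre_eq O A hR)) <
      (maximalIdeal R).comap (Subring.inclusion (model_le_of_locAtCentre_eq O A hR)) := by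
  have hAR : A.toSubring ≤ R := model_le_of_locAtCentre_eq O A hR
  have hle : P ≤ maximalIdeal R := IsLocalRing.le_maximalIdeal hP.ne_top
  refine lt_of_le_of_ne (Ideal.comap_mono hle) fun heq => hPne (le_antisymm hle fun r hr => ?_)
  -- `r = a / c`, `a, c ∈ A`, `v(c) = 1`
  have hr' : (r : K) ∈ locAtCentre A.toSubring O := by rw [hR]; exact r.2
  obtain ⟨a, ha, c, hc, hvc, hrac⟩ := mem_locAtCentre_iff.mp hr'
  have hcR : c ∈ R := hAR hc
  have hcinv : c⁻¹ ∈ R := by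
    rw [← hR]
    exact inv_mem_locAtCentre (le_locAtCentre A.toSubring O hc) hvc
  have hc0 : c ≠ 0 := ne_zero_of_valuation_eq_one hvc
  -- `a = r c ∈ 𝔪_R`, hence `a ∈ 𝔪_R ∩ A = P ∩ A`, so `a ∈ P`
  have haR : a ∈ R := hAR ha
  have hra : (⟨a, haR⟩ : R) = r * ⟨c, hcR⟩ := Subtype.ext (by change a = (r : K) * c; rw [hrac, div_mul_cancel₀ _ hc0])
  have ham : (⟨a, ha⟩ : A.toSubring) ∈ (maximalIdeal R).comap (Subring.inclusion hAR) := by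
    rw [Ideal.mem_comap]
    change (⟨a, haR⟩ : R) ∈ maximalIdeal R
    rw [hra]
    exact Ideal.mul_mem_right _ _ hr
  rw [← heq, Ideal.mem_comap] at ham
  change (⟨a, haR⟩ : R) ∈ P at ham
  -- `r = a · c⁻¹ ∈ P`
  have : r = ⟨a, haR⟩ * ⟨c⁻¹, hcinv⟩ := Subtype.ext (by
    change (r : K) = a * c⁻¹
    rw [hrac, div_eq_mul_inv])
  rw [this]
  exact Ideal.mul_mem_right _ _ ham

include hT

/-- **The GEOMETRIC DATUM of a chain ring** (res-L0-w41-plan-1 RULING 152a; res-L0-w41-strat-2 §σ2.29 (W1)/(W2′)/(W4)): for a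
finitely generated model `A` of dimension `n`, `R = A_{𝔪_O ∩ A}` local, a prime `P ≠ 𝔪_R` of height `c`, and `T = R_P ⊆ K`:
`Q = P ∩ A` is prime, strictly below a prime (`𝔪_R ∩ A`), of coheight `dim (A ⧸ Q) = n − c`, and `T = A_Q` inside `K`
(`∀ z, z ∈ T ↔ z = a / b`, `a ∈ A`, `b ∈ A ∖ Q` — the body of `IsGeomChart A Q T`). [cite: Matsumura1987, Thm. 5.6] [folklore] -/
theorem exists_geomDatum_of_locChar [IsLocalRing R] (hfg : A.FG) (hPne : P ≠ maximalIdeal R) {n c : ℕ}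
    (hn : ringKrullDim A = n) (hc : P.height = c) :
    ∃ Q : Ideal A.toSubring, Q.IsPrime ∧ (∃ Q' : Ideal A.toSubring, Q'.IsPrime ∧ Q < Q') ∧
      ringKrullDim (A.toSubring ⧸ Q) = (n - c : ℕ) ∧
      ∀ z : K, z ∈ T ↔ ∃ a b : A.toSubring, b ∉ Q ∧ z = (a : K) / b :=
  ⟨P.comap (Subring.inclusion (model_le_of_locAtCentre_eq O A hR)), comap_model_isPrime O A hR,
    ⟨(maximalIdeal R).comap (Subring.inclusion (model_le_of_locAtCentre_eq O A hR)), Ideal.comap_isPrime _ _,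
      comap_model_lt_comap_maximalIdeal O A hR hPne⟩,
    ringKrullDim_model_quotient_eq_of_locChar O A hR hT hfg hn hc, locChar_model_of_locChar O A hR hT⟩

/-- The same for the CODIMENSION-ONE case `c + 1 = n` (the `c = 3` members of a `4`-dimensional run: charts at CURVES,
`dim (A ⧸ Q) = 1` — the coheight clause of (W2′)/(W4), res-L0-w41-tri-2 v19 (N1)). [cite: Matsumura1987, Thm. 5.6] [folklore] -/
theorem exists_geomDatum_of_locChar_coheight_one [IsLocalRing R] (hfg : A.FG) (hPne : P ≠ maximalIdeal R) {n c : ℕ}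
    (hn : ringKrullDim A = n) (hc : P.height = c) (hcn : c + 1 = n) :
    ∃ Q : Ideal A.toSubring, Q.IsPrime ∧ (∃ Q' : Ideal A.toSubring, Q'.IsPrime ∧ Q < Q') ∧
      ringKrullDim (A.toSubring ⧸ Q) = 1 ∧
      ∀ z : K, z ∈ T ↔ ∃ a b : A.toSubring, b ∉ Q ∧ z = (a : K) / b := by
  obtain ⟨Q, hQ, hQ', hdim, hchart⟩ := exists_geomDatum_of_locChar O A hR hT hfg hPne hn hc
  refine ⟨Q, hQ, hQ', ?_, hchart⟩
  rw [hdim]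
  have : n - c = 1 := by omega
  rw [this]
  rfl

end GeoDict

end Summit.ResolutionOfSingularities.ResolutionOfSingularities.Theorems.SwitchingDichotomy

end
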